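import Mathlib
import Summits.ResolutionOfSingularities.ResolutionOfSingularities.Theorems.WildQuotientsWildQuotientResolutionJordanFiveTwistedChartI12
import Summits.ResolutionOfSingularities.ResolutionOfSingularities.Theorems.WildQuotientsWildQuotientResolutionJordanFiveTwistedChartCubic
import Summits.ResolutionOfSingularities.ResolutionOfSingularities.Theorems.WildQuotientsWildQuotientResolutionThirdConeVertexPrime

/-!
# RUNG V5 (J₅) — the CUBIC CONE of the `μ₃`-vertex chart: weight of record, generation by vertex monomials, and the `q`-vector lies in it

(crux stmt-ResolutionOfSingularities-15640 `WildQuotients.WildQuotientResolution`, line `Sketch`;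
chain w45c RUNG V5 HP₁ (res-L1-w45c-plan-1 NAMED 2026-08-27T11:35:13Z: stub-1 = the T2-analogue
`eE`, stub-2 = the ring brick over the `ThirdCone` model). Over res-L1-w45c-stub-2's generic cone
`ThirdCone.cone k n w` / `vertexGen` / `monomial_mem_vertexIdeal` (p522660, p527883) and this seat's
`twistedCofactor12` (p527427), `isWeightedHomogeneous_twistedP/D` (p523377). [OURS · L1 W4.5c] — NOT
a statement of any manuscript (Hironaka 2017 is consumed nowhere); replaces the role of no printed
item. Prover res-L1-w45c-stub-1. AI-written Lean, kernel-checked; weaker than expert review.)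

* `JordanFive.cubicWeight n a b c d : Fin n → ZMod 3` — the WEIGHT OF RECORD of the `μ₃`-deck on the
  universal twisted chart: `l = X b ↦ 1`, `ξ = X c ↦ 1`, `A = X a ↦ 2`, `η₁ = X d ↦ 2`, `η₂ = X e`
  and passengers `↦ 0` (RT-J5 §4 characters `(l,A,ξ,η₁,η₂) = (1,2,1,2,0)`); value lemmas.
* GENERIC (any `w : Fin n → ZMod 3`): **`ThirdCone.cone k n w = Algebra.adjoin k (vertex monomials ∪
  passengers)`** (`monomial_mem_adjoin_vertexGen`, `cone_le_adjoin_vertexGen`,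
  `adjoin_vertexGen_eq_cone`) — the cone is generated by stub-2's vertex generators `x_ix_jx_l`
  (weights `1,1,1`), `y_iy_jy_l` (`2,2,2`), `x_iy_j` (`1,2`) and the weight-`0` variables: peel a
  vertex generator off every weight-`0` monomial (stub-2's `monomial_mem_vertexIdeal`, read through
  Mathlib's `mem_ideal_span_monomial_image`) and induct on the degree. For `cubicWeight` these are the
  12 cubic monomials `l³, l²ξ, lξ², ξ³, lA, lη₁, ξA, ξη₁, A³, A²η₁, Aη₁², η₁³` — the TARGET GENERATOR SET
  of the J₅ twist-engine instance (T2-analogue) — plus `η₂` and the passengers.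
* `JordanFive.isWeightedHomogeneous_twistedCofactor12` — every `q_j` is cubic (weight `0`), hence
  `twistedCofactor12_mem_cone`; with T5-ii, `twistedChart_mem_cone` and `twistedQ_mem_cone`.
-/

-- single-problem summit: the doubled namespace component `ResolutionOfSingularities` is forced
set_option linter.dupNamespace false

noncomputable section

open MvPolynomial

namespace Summit.ResolutionOfSingularities.ResolutionOfSingularities.Theorems.WildQuotientResolution.JordanFive

section Generation

/-! ### Generic: the cone is generated by the vertex monomials and the passengers -/

variable (k : Type) [Field k] (n : ℕ) (w : Fin n → ZMod 3)

/-- The generator set: stub-2's vertex monomials together with the weight-`0` variables.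
(A `Set`, not a new object: `Set.range` of existing data.) -/
theorem vertexGen_mem_adjoin (v : ThirdCone.VIdx n w) :
    ((ThirdCone.vertexGen k n w v : ThirdCone.cone k n w) : MvPolynomial (Fin n) k) ∈
      Algebra.adjoin k (Set.range (fun v : ThirdCone.VIdx n w =>
          ((ThirdCone.vertexGen k n w v : ThirdCone.cone k n w) : MvPolynomial (Fin n) k)) ∪
        (fun i : Fin n => (X i : MvPolynomial (Fin n) k)) '' {i | w i = 0}) :=
  Algebra.subset_adjoin (Or.inl ⟨v, rfl⟩)

include k in
/-- If a weight-`0` monomial touches a non-passenger variable, some vertex exponent lies below it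
(stub-2's `ThirdCone.monomial_mem_vertexIdeal`, read through `mem_ideal_span_monomial_image`).
[OURS · L1 W4.5c] -/
theorem exists_vertexExp_le (e : Fin n →₀ ℕ) (he : Finsupp.weight w e = 0)
    (hs : ∃ s, w s ≠ 0 ∧ 1 ≤ e s) : ∃ v : ThirdCone.VIdx n w, ThirdCone.vertexExp n w v ≤ e := by
  classical
  have hmem := ThirdCone.monomial_mem_vertexIdeal k n w e he hs
  -- push the ideal membership down to `k[x]`
  have hmap : (monomial e (1 : k) : MvPolynomial (Fin n) k) ∈
      Ideal.span ((fun s => monomial s (1 : k)) '' Set.range (ThirdCone.vertexExp n w)) := by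
    have h1 := Ideal.mem_map_of_mem (ThirdCone.cone k n w).val.toRingHom hmem
    rw [ThirdCone.vertexIdeal, Ideal.map_span, ThirdCone.range_vertexFamily] at h1
    have hset : ((ThirdCone.cone k n w).val.toRingHom : ThirdCone.cone k n w → MvPolynomial (Fin n) k) ''
        Set.range (ThirdCone.vertexGen k n w) =
        (fun s => monomial s (1 : k)) '' Set.range (ThirdCone.vertexExp n w) := by
      ext f
      constructor
      · rintro ⟨_, ⟨v, rfl⟩, rfl⟩
        exact ⟨ThirdCone.vertexExp n w v, ⟨v, rfl⟩, (ThirdCone.coe_vertexGen k n w v).symm⟩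
      · rintro ⟨_, ⟨v, rfl⟩, rfl⟩
        exact ⟨ThirdCone.vertexGen k n w v, ⟨v, rfl⟩, ThirdCone.coe_vertexGen k n w v⟩
    rw [hset] at h1
    exact h1
  have h2 := (mem_ideal_span_monomial_image.mp hmap) e (by
    rw [mem_support_iff, coeff_monomial, if_pos rfl]; exact one_ne_zero)
  obtain ⟨_, ⟨v, rfl⟩, hle⟩ := h2
  exact ⟨v, hle⟩

/-- **Every weight-`0` monomial is a product of vertex monomials and passengers.** [OURS · L1 W4.5c] -/
theorem monomial_mem_adjoin_vertexGen (e : Fin n →₀ ℕ) (he : Finsupp.weight w e = 0) :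
    (monomial e (1 : k) : MvPolynomial (Fin n) k) ∈
      Algebra.adjoin k (Set.range (fun v : ThirdCone.VIdx n w =>
          ((ThirdCone.vertexGen k n w v : ThirdCone.cone k n w) : MvPolynomial (Fin n) k)) ∪
        (fun i : Fin n => (X i : MvPolynomial (Fin n) k)) '' {i | w i = 0}) := by
  classical
  set A := Algebra.adjoin k (Set.range (fun v : ThirdCone.VIdx n w =>
          ((ThirdCone.vertexGen k n w v : ThirdCone.cone k n w) : MvPolynomial (Fin n) k)) ∪
        (fun i : Fin n => (X i : MvPolynomial (Fin n) k)) '' {i | w i = 0}) with hA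
  -- strong induction on the degree of `e`
  induction hN : e.degree using Nat.strong_induction_on generalizing e with
  | _ N ih =>
    by_cases hs : ∃ s, w s ≠ 0 ∧ 1 ≤ e s
    · obtain ⟨v, hle⟩ := exists_vertexExp_le k n w e he hs
      have hsplit : ThirdCone.vertexExp n w v + (e - ThirdCone.vertexExp n w v) = e :=
        add_tsub_cancel_of_le hle
      have hw' : Finsupp.weight w (e - ThirdCone.vertexExp n w v) = 0 := by
        have h := congrArg (Finsupp.weight w) hsplit
        rwa [map_add, ThirdCone.weight_vertexExp, zero_add, he] at h
      have hdegv : 1 ≤ (ThirdCone.vertexExp n w v).degree := by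
        rcases v with ⟨i, j, l⟩ | ⟨i, j, l⟩ | ⟨i, j⟩ <;>
          simp [ThirdCone.vertexExp, map_add, Finsupp.degree_single]
      have hlt : (e - ThirdCone.vertexExp n w v).degree < N := by
        have h := congrArg Finsupp.degree hsplit
        rw [map_add, hN] at h
        omega
      have hfac : (monomial e (1 : k) : MvPolynomial (Fin n) k) =
          ((ThirdCone.vertexGen k n w v : ThirdCone.cone k n w) : MvPolynomial (Fin n) k) *
            monomial (e - ThirdCone.vertexExp n w v) 1 := by
        rw [ThirdCone.coe_vertexGen, monomial_mul, one_mul, hsplit]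
      rw [hfac]
      exact A.mul_mem (vertexGen_mem_adjoin k n w v) (ih _ hlt _ hw' rfl)
    · -- `e` is supported on passengers
      push Not at hs
      have hz : ∀ s ∈ e.support, w s = 0 := by
        intro s hs'
        by_contra hw0
        have h := hs s hw0
        rw [Finsupp.mem_support_iff] at hs'
        omega
      rw [monomial_eq, C_1, one_mul, Finsupp.prod]
      refine A.prod_mem fun s hs' => A.pow_mem ?_ _
      exact Algebra.subset_adjoin (Or.inr ⟨s, hz s hs', rfl⟩)

/-- **`cone ≤ adjoin (vertex monomials ∪ passengers)`.** [OURS · L1 W4.5c] -/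
theorem cone_le_adjoin_vertexGen :
    ThirdCone.cone k n w ≤
      Algebra.adjoin k (Set.range (fun v : ThirdCone.VIdx n w =>
          ((ThirdCone.vertexGen k n w v : ThirdCone.cone k n w) : MvPolynomial (Fin n) k)) ∪
        (fun i : Fin n => (X i : MvPolynomial (Fin n) k)) '' {i | w i = 0}) := by
  classical
  intro f hf
  rw [ThirdCone.mem_cone_iff] at hf
  rw [f.as_sum]
  refine Subalgebra.sum_mem _ fun e he => ?_
  have hwe : Finsupp.weight w e = 0 := hf (mem_support_iff.mp he)
  have e1 : monomial e (coeff e f) = algebraMap k (MvPolynomial (Fin n) k) (coeff e f) * monomial e 1 := by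
    rw [MvPolynomial.algebraMap_eq, C_mul_monomial, mul_one]
  rw [e1]
  exact Subalgebra.mul_mem _ (Subalgebra.algebraMap_mem _ _) (monomial_mem_adjoin_vertexGen k n w e hwe)

/-- **`adjoin (vertex monomials ∪ passengers) = cone`** (the generators are weight-`0`).
[OURS · L1 W4.5c] -/
theorem adjoin_vertexGen_eq_cone :
    Algebra.adjoin k (Set.range (fun v : ThirdCone.VIdx n w =>
          ((ThirdCone.vertexGen k n w v : ThirdCone.cone k n w) : MvPolynomial (Fin n) k)) ∪
        (fun i : Fin n => (X i : MvPolynomial (Fin n) k)) '' {i | w i = 0}) =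
      ThirdCone.cone k n w := by
  refine le_antisymm (Algebra.adjoin_le ?_) (cone_le_adjoin_vertexGen k n w)
  rintro f (⟨v, rfl⟩ | ⟨i, hi, rfl⟩)
  · exact (ThirdCone.vertexGen k n w v).2
  · change IsWeightedHomogeneous w (X i : MvPolynomial (Fin n) k) 0
    have h := isWeightedHomogeneous_X k w i
    rwa [show w i = 0 from hi] at h

end Generation

section CubicWeight

/-! ### The weight of record of the `μ₃`-deck and the `q`-vector -/

variable (k : Type) [Field k] (n : ℕ) (a b c d e : Fin n)
  (hab : a ≠ b) (hac : a ≠ c) (had : a ≠ d) (hae : a ≠ e) (hbc : b ≠ c) (hbd : b ≠ d) (hbe : b ≠ e)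
  (hcd : c ≠ d) (hce : c ≠ e) (hde : d ≠ e)

/-- **The `μ₃`-weight of record** on `k[l, A, ξ, η₁, η₂, passengers]` (slots `l = X b`, `A = X a`,
`ξ = X c`, `η₁ = X d`): `b ↦ 1`, `c ↦ 1`, `a ↦ 2`, `d ↦ 2`, everything else `↦ 0`. [OURS · L1 W4.5c] -/
def cubicWeight : Fin n → ZMod 3 :=
  fun i => if i = a then 2 else if i = b then 1 else if i = c then 1 else if i = d then 2 else 0

/-- `cubicWeight a = 2`. [OURS · L1 W4.5c] -/
theorem cubicWeight_a : cubicWeight n a b c d a = 2 := by simp [cubicWeight]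

include hab in
/-- `cubicWeight b = 1`. [OURS · L1 W4.5c] -/
theorem cubicWeight_b : cubicWeight n a b c d b = 1 := by simp [cubicWeight, hab.symm]

include hac hbc in
/-- `cubicWeight c = 1`. [OURS · L1 W4.5c] -/
theorem cubicWeight_c : cubicWeight n a b c d c = 1 := by simp [cubicWeight, hac.symm, hbc.symm]

include had hbd hcd in
/-- `cubicWeight d = 2`. [OURS · L1 W4.5c] -/
theorem cubicWeight_d : cubicWeight n a b c d d = 2 := by
  simp [cubicWeight, had.symm, hbd.symm, hcd.symm]

/-- Passengers (and `η₂ = X e`) have weight `0`. [OURS · L1 W4.5c] -/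
theorem cubicWeight_of_ne (i : Fin n) (hia : i ≠ a) (hib : i ≠ b) (hic : i ≠ c) (hid : i ≠ d) :
    cubicWeight n a b c d i = 0 := by simp [cubicWeight, hia, hib, hic, hid]

/-- `cubicWeight i = 0 ↔ i ∉ {a, b, c, d}`. [OURS · L1 W4.5c] -/
theorem cubicWeight_eq_zero_iff (i : Fin n) :
    cubicWeight n a b c d i = 0 ↔ i ≠ a ∧ i ≠ b ∧ i ≠ c ∧ i ≠ d := by
  constructor
  · intro h
    refine ⟨fun hi => ?_, fun hi => ?_, fun hi => ?_, fun hi => ?_⟩ <;> subst hi <;>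
      simp [cubicWeight] at h <;>
      first | exact absurd h (by decide) | (split_ifs at h <;> exact absurd h (by decide))
  · rintro ⟨hia, hib, hic, hid⟩
    exact cubicWeight_of_ne n a b c d i hia hib hic hid

include hab hac hbc in
/-- `cubicWeight i = 1 ↔ i = b ∨ i = c`. [OURS · L1 W4.5c] -/
theorem cubicWeight_eq_one_iff (i : Fin n) : cubicWeight n a b c d i = 1 ↔ i = b ∨ i = c := by
  constructor
  · intro h
    by_contra hne
    push Not at hne
    simp only [cubicWeight, if_neg hne.1, if_neg hne.2] at h
    split_ifs at h <;> exact absurd h (by decide)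
  · rintro (rfl | rfl)
    · exact cubicWeight_b n a i c d hab
    · exact cubicWeight_c n a b i d hac hbc

include had hbd hcd in
/-- `cubicWeight i = 2 ↔ i = a ∨ i = d`. [OURS · L1 W4.5c] -/
theorem cubicWeight_eq_two_iff (i : Fin n) : cubicWeight n a b c d i = 2 ↔ i = a ∨ i = d := by
  constructor
  · intro h
    by_contra hne
    push Not at hne
    simp only [cubicWeight, if_neg hne.1, if_neg hne.2] at h
    split_ifs at h <;> exact absurd h (by decide)
  · rintro (rfl | rfl)
    · exact cubicWeight_a n i b c d
    · exact cubicWeight_d n a b c i had hbd hcd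

include hab hac had hbc hbd hcd in
/-- **Every `q_j` is cubic** (`μ₃`-weight `0`): `q_j = l^{w−12} A^α (1+Aξ)^β P^γ (D/6)^δ` has weight
`(w − 12) + 2α + γ + 2δ = 6α + 3β + 3γ + 3δ − 12 ≡ 0 (mod 3)`. [OURS · L1 W4.5c] -/
theorem isWeightedHomogeneous_twistedCofactor12 (j : Fin 40) :
    IsWeightedHomogeneous (cubicWeight n a b c d) (twistedCofactor12 k n a b c d j) 0 := by
  set w := cubicWeight n a b c d with hw
  have hwa : w a = 2 := cubicWeight_a n a b c d
  have hwb : w b = 1 := cubicWeight_b n a b c d hab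
  have hwc : w c = 1 := cubicWeight_c n a b c d hac hbc
  have hwd : w d = 2 := cubicWeight_d n a b c d had hbd hcd
  have hXa : IsWeightedHomogeneous w (X a : MvPolynomial (Fin n) k) 2 := hwa ▸ isWeightedHomogeneous_X k w a
  have hXb : IsWeightedHomogeneous w (X b : MvPolynomial (Fin n) k) 1 := hwb ▸ isWeightedHomogeneous_X k w b
  have hXc : IsWeightedHomogeneous w (X c : MvPolynomial (Fin n) k) 1 := hwc ▸ isWeightedHomogeneous_X k w c
  have h1 : IsWeightedHomogeneous w (1 + X a * X c : MvPolynomial (Fin n) k) 0 := by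
    have h := hXa.mul hXc
    exact (isWeightedHomogeneous_one k w).add (isWeightedHomogeneous_of_eq k n w h (by decide))
  have hP : IsWeightedHomogeneous w (JordanFour.twistedP k n a b c d) 1 :=
    isWeightedHomogeneous_twistedP k n a b c d w hwa hwb hwc hwd
  have hD : IsWeightedHomogeneous w (C (6⁻¹ : k) * twistedD k n a b c d) 2 :=
    (isWeightedHomogeneous_twistedD k n a b c d w hwa hwb hwc hwd).C_mul _
  -- the generic product
  have hprod : ∀ i α β γ δ : ℕ, IsWeightedHomogeneous w
      (X b ^ i * X a ^ α * (1 + X a * X c) ^ β * JordanFour.twistedP k n a b c d ^ γ *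
        (C (6⁻¹ : k) * twistedD k n a b c d) ^ δ)
      (i • (1 : ZMod 3) + α • (2 : ZMod 3) + β • (0 : ZMod 3) + γ • (1 : ZMod 3) + δ • (2 : ZMod 3)) :=
    fun i α β γ δ => ((((hXb.pow i).mul (hXa.pow α)).mul (h1.pow β)).mul (hP.pow γ)).mul (hD.pow δ)
  unfold twistedCofactor12
  refine isWeightedHomogeneous_of_eq k n w (hprod _ _ _ _ _) ?_
  fin_cases j <;> simp [exps12] <;> decide

include hab hac had hbc hbd hcd in
/-- `q_j ∈ ThirdCone.cone (cubicWeight)`. [OURS · L1 W4.5c] -/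
theorem twistedCofactor12_mem_cone (j : Fin 40) :
    twistedCofactor12 k n a b c d j ∈ ThirdCone.cone k n (cubicWeight n a b c d) :=
  isWeightedHomogeneous_twistedCofactor12 k n a b c d hab hac had hbc hbd hcd j

include hab hac had hae hbc hbd hbe hcd hce hde in
/-- **The universal twisted chart lands in the cubic cone** (T5-ii in `ThirdCone` language).
[OURS · L1 W4.5c] -/
theorem twistedChart_mem_cone (f : MvPolynomial (Fin n) k) :
    twistedChart k n a b c d e f ∈ ThirdCone.cone k n (cubicWeight n a b c d) :=
  isWeightedHomogeneous_twistedChart k n a b c d e (cubicWeight n a b c d) (cubicWeight_a n a b c d)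
    (cubicWeight_b n a b c d hab) (cubicWeight_c n a b c d hac hbc) (cubicWeight_d n a b c d had hbd hcd)
    (fun i hia hib hic hid => cubicWeight_of_ne n a b c d i hia hib hic hid)
    hab hac had hae hbc hbd hbe hcd hce hde f

include hab had hbd hcd in
/-- `Q = 1 − 3lA + A²η₁` lies in the cubic cone. [OURS · L1 W4.5c] -/
theorem twistedQ_mem_cone :
    JordanFour.twistedQ k n a b d ∈ ThirdCone.cone k n (cubicWeight n a b c d) :=
  isWeightedHomogeneous_twistedQ k n a b d (cubicWeight n a b c d) (cubicWeight_a n a b c d)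
    (cubicWeight_b n a b c d hab) (cubicWeight_d n a b c d had hbd hcd)

end CubicWeight

end Summit.ResolutionOfSingularities.ResolutionOfSingularities.Theorems.WildQuotientResolution.JordanFive

end
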